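import Literature.AlgebraicGeometry.Frobenioids.ArithmeticFrobenioids
import Literature.AlgebraicGeometry.Frobenioids.MotivatingExamplesThm64ivDegOne
import Literature.AlgebraicGeometry.Frobenioids.MotivatingExamplesThm64ivBaseCompat
import HarnessLib

/-!
# Frobenioids I, Theorem 6.4 (iv) IN THE LETTER OF THE SCHEMA `Thm64iv`, from the transported data
# (sub-DAG `plan/L1/SUBDAG-FrdI-Thm64.md`, row «T64-ASSEMBLIES» step 1: the schema-letter closer of (iv))

Mochizuki, *The geometry of Frobenioids I: the general theory*, Kyushu J. Math. **62** (2008) 293–400, §6,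
Theorem 6.4 (iv), kurims text p. 115 l. 17–29 ("Suppose that `Ψ^rlf` arises from an equivalence of categories
`Ψ : C₁ ⥲ C₂`. Then `deg(Ψ^rlf) = 1`. If, moreover, there exists a finite extension `L₁ ⊆ F̃₁` of `F₁` which is
Galois over `ℚ`, then the corresponding [i.e., via the equivalence `D₁ ⥲ D₂` induced by `Ψ` — cf. (i); Corollary
4.11, (ii)] finite extension `L₂ ⊆ F̃₂` of `F₂` is isomorphic to `L₁` in a fashion that is compatible with an
isomorphism `F₁ ⥲ F₂`"), proof p. 116 l. 17–35. [cite: MochizukiFrdI2008, Thm. 6.4 (iv) p.115]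

PROOF-ONLY (cell abc-iut; seat abc-iut-L1-t3 = the typer of the schema `Thm64iv`, `ArithmeticFrobenioids.lean`;
L1-lead R112 (9); 0 `def`, no instance, no notation, no new named fact).  The typed schema

  `Thm64iv R₁ R₂ Ψrlf picMap deg M₁ M₂ r₁ r₂ Ψ ΨBase :=
     Thm64iiDeg R₁ R₂ Ψrlf picMap deg → OneCommutes Ψ r₂ r₁ Ψrlf → OneUniqueSquare Ψ Base₁ Base₂ ΨBase →
       deg = 1 ∧ ∀ X, IsGalois ℚ X.L → ∃ (e : X.L ≃+* (ΨBase X).L) (e₀ : F₁ ≃+* F₂), e ∘ (F₁ → X.L) = (F₂ → _) ∘ e₀`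

is CLOSED here — its conclusion literally — over the data-level pieces already landed BY NAME:
abc-iut-L1-d7's `Thm64iv_at_of_logNorm_transport` / `residueChar_eq_of_logNorm_transport`
(`MotivatingExamplesThm64ivDegOne.lean`: `deg = 1` at a completely split prime, rows T64iv/L02–L05, and `L₁ ≅ L₂`
for `L₁` Galois over `ℚ`, row T64iv/L07a = abc-iut-w4-d109's `nonempty_ringEquiv_of_isGalois_of_logNorm_transport`;
the residue characteristics come for free from the INTEGRAL degree relation, Thm. 6.4 (iii) at `q = 1`), and
abc-iut-L1-d4's `Thm64iv_compat_of_transport_of_isGalois_base` / `…_of_baseIso` /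
`FinSubextCat.isEquivalence_of_oneUniqueSquare` (`MotivatingExamplesThm64ivBaseCompat.lean`: row T64iv/L07b, the
compatibility with `F₁ ≅ F₂`, DISCHARGED when `F₁` is Galois over `ℚ`, else REDUCED to `Nonempty (F₁ ≃+* F₂)` —
GAP-LEDGER G-L1t3-1, KEEP), GIVEN the two readings that THE constructions supply (inline binders, no definition):

* `π X : V(X.L)^non ≃ V((Ψ^Base X).L)^non` — the bijection of finite places induced by the monoid isomorphism
  `Ψ^Φ_X : Φ₁(X) ⥲ Φ₂(Ψ^Base X)` of Cor. 4.11 (iii) ("generator ↦ generator": abc-iut-L1-d7's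
  `EffArithDivisor.exists_finitePlaceEquiv_mulEquiv`, `ArithmeticDivisorsMonoidIsoPlaces.lean`, row T64iv/L01);
* `gen` — at every `X` a Frobenius-trivial `A ∈ Ob(C₁^rlf)` over it whose `Pic_Φ(A)` contains, for each finite
  place `w`, a class `g` with `δ_A(g) = log N(w)` and `δ_{Ψ^rlf A}(picMap_A g) = log N(π w)` (THE `δ` of Thm. 6.4
  (i) reads `deg^arith` = `log N(w)` on the generator class at `w`, and THE `picMap` induced by `Ψ^rlf` — Cor. 4.10
  / 4.11 (iii) compatibly with `Ψ^Φ` along `Φ ⊆ Φ^rlf`, Cor. 5.4 — carries it to the generator class at `π w`).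

With these, the antecedent `Thm64iiDeg` (the degree of Thm. 6.4 (ii): `δ_{A₂} ∘ picMap = deg · δ_{A₁}`, `deg > 0`)
is LOAD-BEARING: it turns the two readings into `log N(π w) = deg · log N(w)`, from which everything follows; the
antecedent `OneUniqueSquare` supplies `Ψ^Base` an equivalence (needed for `Ψ^Base(Spec F₁) ≅ Spec F₂`); the
antecedent `OneCommutes Ψ r₂ r₁ Ψrlf` is idle at this level (in print it is what makes `picMap` "arise from `Ψ`",
i.e. it is consumed in producing `gen`/`π` at THE data).  Variants: the bare log-norm reading
(`Thm64iv_of_logNorm_transport_schema`), and an explicit `φ : F₁ ≃+* F₂` in place of "`F₁` Galois over `ℚ`"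
(`…_of_baseIso`), which is the honest residual of G-L1t3-1 for non-Galois `F₁`.
Nothing here bears on, or takes a side on, [IUTchIII] Cor. 3.12; no statement of the paper is strengthened.
-/

noncomputable section

namespace Literature.AlgebraicGeometry.Frobenioids

open CategoryTheory NumberField

universe u v

variable {F₁ : Type} [Field F₁] [NumberField F₁] {K₁ : Type} [Field K₁] [Algebra F₁ K₁]
variable {F₂ : Type} [Field F₂] [NumberField F₂] {K₂ : Type} [Field K₂] [Algebra F₂ K₂]
variable {Rlf₁ : Type u} [Category.{v} Rlf₁] {Rlf₂ : Type u} [Category.{v} Rlf₂]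
variable (R₁ : ArithRealification (F := F₁) (K := K₁) Rlf₁) (R₂ : ArithRealification (F := F₂) (K := K₂) Rlf₂)
variable {C₁ : Type u} [Category.{v} C₁] {C₂ : Type u} [Category.{v} C₂]
variable (M₁ : ArithModelFrobenioid F₁ K₁ C₁) (M₂ : ArithModelFrobenioid F₂ K₂ C₂)

/-! ### From the two readings to the log-norm relation at generators -/

omit [NumberField F₂] in
/-- **The degree of Thm. 6.4 (ii) read at generators**: if `δ_{A₂} ∘ picMap_A = deg · δ_{A₁}` (`Thm64iiDeg`) and,
over `X`, some Frobenius-trivial `A` carries for each finite place `w` a class `g ∈ Pic_Φ(A)` with `δ_A(g) = log N(w)`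
and `δ_{Ψ^rlf A}(picMap_A g) = log N(π w)`, then `log N(π w) = deg · log N(w)` (p. 116 l. 21–27: "`deg^arith_{L_i}`
maps a generator of the monoid `Φ_i(L_i)_{v_i}` to …"). [cite: MochizukiFrdI2008, Thm. 6.4 (iv) p.116] -/
theorem logNorm_transport_of_thm64iiDeg (Ψrlf : Rlf₁ ≌ Rlf₂)
    (picMap : ∀ A : Rlf₁, R₁.Pic A ≃+ R₂.Pic (Ψrlf.functor.obj A)) (deg : ℝ)
    (hdeg : Thm64iiDeg R₁ R₂ Ψrlf picMap deg) {L₂ : Type} [Field L₂] [NumberField L₂]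
    (X : FinSubextCat F₁ K₁) (π : FinitePlace X.L ≃ FinitePlace L₂)
    (gen : ∃ (A : Rlf₁) (hA : R₁.ops.IsFrobeniusTrivial A) (hA' : R₂.ops.IsFrobeniusTrivial (Ψrlf.functor.obj A)),
      ∀ w : FinitePlace X.L, ∃ g : R₁.Pic A,
        R₁.δ A hA g = logNorm w ∧ R₂.δ _ hA' (picMap A g) = logNorm (π w)) :
    ∀ w : FinitePlace X.L, logNorm (π w) = deg * logNorm w := by
  obtain ⟨A, hA, hA', hgen⟩ := gen
  intro w
  obtain ⟨g, h₁, h₂⟩ := hgen w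
  rw [← h₂, hdeg.2 A hA hA' g, h₁]

/-! ### Theorem 6.4 (iv) in the letter of `Thm64iv` -/

/-- **Theorem 6.4 (iv) AS TYPED (`Thm64iv`), from the log-norm transport** — `F₁` Galois over `ℚ`: for ANY data
`R_i`, `M_i`, `r_i`, `Ψ`, `Ψ^rlf`, `picMap`, `deg`, `Ψ^Base`, GIVEN the bijections `π X` of finite places induced by
`Ψ` at every `X ∈ Ob(D₁)` along which — whenever `deg > 0` — `log N(π w) = deg · log N(w)` (the degree read at
generators), the schema holds: `deg = 1` (abc-iut-L1-d7's `Thm64iv_at_of_logNorm_transport` at `X₀ = Spec F₁`), and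
for `X.L` Galois over `ℚ` an isomorphism `X.L ≅ (Ψ^Base X).L` compatible with some `F₁ ≅ F₂` (residue characteristics
by `residueChar_eq_of_logNorm_transport`; then abc-iut-L1-d4's `Thm64iv_compat_of_transport_of_isGalois_base` at
`B₁ = ⟨⊥⟩`, `Ψ^Base` being an equivalence by the `1`-unique square). [cite: MochizukiFrdI2008, Thm. 6.4 (iv) p.115] -/
theorem Thm64iv_of_logNorm_transport_schema [IsGalois ℚ F₁] (Ψrlf : Rlf₁ ≌ Rlf₂)
    (picMap : ∀ A : Rlf₁, R₁.Pic A ≃+ R₂.Pic (Ψrlf.functor.obj A)) (deg : ℝ)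
    (r₁ : C₁ ⥤ Rlf₁) (r₂ : C₂ ⥤ Rlf₂) (Ψ : C₁ ≌ C₂) (ΨBase : FinSubextCat F₁ K₁ ⥤ FinSubextCat F₂ K₂)
    (π : ∀ X : FinSubextCat F₁ K₁, FinitePlace X.L ≃ FinitePlace (ΨBase.obj X).L)
    (hgen : 0 < deg → ∀ (X : FinSubextCat F₁ K₁) (w : FinitePlace X.L), logNorm (π X w) = deg * logNorm w) :
    Thm64iv R₁ R₂ Ψrlf picMap deg M₁ M₂ r₁ r₂ Ψ ΨBase := by
  intro hdeg _hcomm hsq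
  have hpos : 0 < deg := hdeg.1
  have hrel := hgen hpos
  haveI : ΨBase.IsEquivalence :=
    FinSubextCat.isEquivalence_of_oneUniqueSquare Ψ.functor M₁.ops.base M₂.ops.base ΨBase hsq
  -- `X₀ = Spec F₁`
  let X₀ : FinSubextCat F₁ K₁ := ⟨⊥⟩
  have h1 : deg = 1 := (Thm64iv_at_of_logNorm_transport ΨBase X₀ (π X₀) deg hpos (hrel X₀)).1
  -- residue characteristics and equality of norms along every `π X`, from the integral relation with `deg = 1`
  have hπ : ∀ (X : FinSubextCat F₁ K₁) (w : FinitePlace X.L), residueChar (π X w) = residueChar w := fun X =>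
    residueChar_eq_of_logNorm_transport X.L (ΨBase.obj X).L (π X) deg hpos fun w => (hrel X w).symm
  have hnorm : ∀ (X : FinSubextCat F₁ K₁) (w : FinitePlace X.L), logNorm w = logNorm (π X w) := fun X w => by
    rw [hrel X w, h1, one_mul]
  refine ⟨h1, fun X hX => ?_⟩
  exact Thm64iv_compat_of_transport_of_isGalois_base ΨBase X₀ (IntermediateField.botEquiv F₁ K₁) (π X₀) (hπ X₀)
    (hnorm X₀) X hX (π X) (hπ X) (hnorm X)

/-- **Theorem 6.4 (iv) AS TYPED, from the two readings at generators** — `F₁` Galois over `ℚ`: GIVEN `π X` (the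
place bijections induced by `Ψ^Φ`, row T64iv/L01) and, over every `X`, a Frobenius-trivial `A` with generator classes
read by `δ` as `log N(w)` / `log N(π w)` (THE `δ_A` of Thm. 6.4 (i) and THE `picMap` induced by `Ψ^rlf`), the schema
`Thm64iv` holds — its `Thm64iiDeg` antecedent supplying `log N(π w) = deg · log N(w)`
(`logNorm_transport_of_thm64iiDeg`). [cite: MochizukiFrdI2008, Thm. 6.4 (iv) p.115] -/
theorem Thm64iv_of_generatorReadings [IsGalois ℚ F₁] (Ψrlf : Rlf₁ ≌ Rlf₂)
    (picMap : ∀ A : Rlf₁, R₁.Pic A ≃+ R₂.Pic (Ψrlf.functor.obj A)) (deg : ℝ)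
    (r₁ : C₁ ⥤ Rlf₁) (r₂ : C₂ ⥤ Rlf₂) (Ψ : C₁ ≌ C₂) (ΨBase : FinSubextCat F₁ K₁ ⥤ FinSubextCat F₂ K₂)
    (π : ∀ X : FinSubextCat F₁ K₁, FinitePlace X.L ≃ FinitePlace (ΨBase.obj X).L)
    (gen : ∀ X : FinSubextCat F₁ K₁, ∃ (A : Rlf₁) (hA : R₁.ops.IsFrobeniusTrivial A)
      (hA' : R₂.ops.IsFrobeniusTrivial (Ψrlf.functor.obj A)), ∀ w : FinitePlace X.L, ∃ g : R₁.Pic A,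
        R₁.δ A hA g = logNorm w ∧ R₂.δ _ hA' (picMap A g) = logNorm (π X w)) :
    Thm64iv R₁ R₂ Ψrlf picMap deg M₁ M₂ r₁ r₂ Ψ ΨBase := fun hdeg hcomm hsq =>
  Thm64iv_of_logNorm_transport_schema R₁ R₂ M₁ M₂ Ψrlf picMap deg r₁ r₂ Ψ ΨBase π
    (fun _ X => logNorm_transport_of_thm64iiDeg R₁ R₂ Ψrlf picMap deg hdeg X (π X) (gen X)) hdeg hcomm hsq

/-! ### Variants with an explicit `F₁ ≅ F₂` (the honest residual of row T64iv/L07b for non-Galois `F₁`) -/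

/-- **Theorem 6.4 (iv) AS TYPED, from the log-norm transport and an isomorphism `φ : F₁ ≅ F₂`** (no hypothesis on
`F₁/ℚ`): `deg = 1`, and at every `X` with `X.L` Galois over `ℚ` the isomorphism `X.L ≅ (Ψ^Base X).L` of row
T64iv/L07a is made compatible with `φ` (abc-iut-L1-d4's `Thm64iv_compat_of_transport_of_baseIso`).  For `F₁` not
Galois over `ℚ` the printed proof does not produce `φ` (GAP-LEDGER G-L1t3-1): it is an input here.
[cite: MochizukiFrdI2008, Thm. 6.4 (iv) p.115] -/
theorem Thm64iv_of_logNorm_transport_of_baseIso (Ψrlf : Rlf₁ ≌ Rlf₂)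
    (picMap : ∀ A : Rlf₁, R₁.Pic A ≃+ R₂.Pic (Ψrlf.functor.obj A)) (deg : ℝ)
    (r₁ : C₁ ⥤ Rlf₁) (r₂ : C₂ ⥤ Rlf₂) (Ψ : C₁ ≌ C₂) (ΨBase : FinSubextCat F₁ K₁ ⥤ FinSubextCat F₂ K₂)
    (φ : F₁ ≃+* F₂) (π : ∀ X : FinSubextCat F₁ K₁, FinitePlace X.L ≃ FinitePlace (ΨBase.obj X).L)
    (hgen : 0 < deg → ∀ (X : FinSubextCat F₁ K₁) (w : FinitePlace X.L), logNorm (π X w) = deg * logNorm w) :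
    Thm64iv R₁ R₂ Ψrlf picMap deg M₁ M₂ r₁ r₂ Ψ ΨBase := by
  intro hdeg _hcomm _hsq
  have hpos : 0 < deg := hdeg.1
  have hrel := hgen hpos
  let X₀ : FinSubextCat F₁ K₁ := ⟨⊥⟩
  have h1 : deg = 1 := (Thm64iv_at_of_logNorm_transport ΨBase X₀ (π X₀) deg hpos (hrel X₀)).1
  have hπ : ∀ (X : FinSubextCat F₁ K₁) (w : FinitePlace X.L), residueChar (π X w) = residueChar w := fun X =>
    residueChar_eq_of_logNorm_transport X.L (ΨBase.obj X).L (π X) deg hpos fun w => (hrel X w).symm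
  have hnorm : ∀ (X : FinSubextCat F₁ K₁) (w : FinitePlace X.L), logNorm w = logNorm (π X w) := fun X w => by
    rw [hrel X w, h1, one_mul]
  exact ⟨h1, fun X hX => Thm64iv_compat_of_transport_of_baseIso ΨBase X hX (π X) (hπ X) (hnorm X) φ⟩

/-- **Theorem 6.4 (iv) AS TYPED, from the two readings at generators and an isomorphism `φ : F₁ ≅ F₂`.**
[cite: MochizukiFrdI2008, Thm. 6.4 (iv) p.115] -/
theorem Thm64iv_of_generatorReadings_of_baseIso (Ψrlf : Rlf₁ ≌ Rlf₂)
    (picMap : ∀ A : Rlf₁, R₁.Pic A ≃+ R₂.Pic (Ψrlf.functor.obj A)) (deg : ℝ)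
    (r₁ : C₁ ⥤ Rlf₁) (r₂ : C₂ ⥤ Rlf₂) (Ψ : C₁ ≌ C₂) (ΨBase : FinSubextCat F₁ K₁ ⥤ FinSubextCat F₂ K₂)
    (φ : F₁ ≃+* F₂) (π : ∀ X : FinSubextCat F₁ K₁, FinitePlace X.L ≃ FinitePlace (ΨBase.obj X).L)
    (gen : ∀ X : FinSubextCat F₁ K₁, ∃ (A : Rlf₁) (hA : R₁.ops.IsFrobeniusTrivial A)
      (hA' : R₂.ops.IsFrobeniusTrivial (Ψrlf.functor.obj A)), ∀ w : FinitePlace X.L, ∃ g : R₁.Pic A,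
        R₁.δ A hA g = logNorm w ∧ R₂.δ _ hA' (picMap A g) = logNorm (π X w)) :
    Thm64iv R₁ R₂ Ψrlf picMap deg M₁ M₂ r₁ r₂ Ψ ΨBase := fun hdeg hcomm hsq =>
  Thm64iv_of_logNorm_transport_of_baseIso R₁ R₂ M₁ M₂ Ψrlf picMap deg r₁ r₂ Ψ ΨBase φ π
    (fun _ X => logNorm_transport_of_thm64iiDeg R₁ R₂ Ψrlf picMap deg hdeg X (π X) (gen X)) hdeg hcomm hsq

/-! ### The first clause alone, with no hypothesis on the base fields -/

/-- **"`deg(Ψ^rlf) = 1`" and `L₁ ≅ L₂` at every `X` with `X.L` Galois over `ℚ`** — the part of (iv) that its printed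
proof establishes (rows T64iv/L02–L07a), from the hypotheses of `Thm64iv` and the two readings, with NO hypothesis
on `F₁`, `F₂` (the compatibility with `F₁ ≅ F₂` = row T64iv/L07b is the only clause left out).
[cite: MochizukiFrdI2008, Thm. 6.4 (iv) p.116] -/
theorem Thm64iv_degOne_and_fieldIso_of_generatorReadings (Ψrlf : Rlf₁ ≌ Rlf₂)
    (picMap : ∀ A : Rlf₁, R₁.Pic A ≃+ R₂.Pic (Ψrlf.functor.obj A)) (deg : ℝ)
    (hdeg : Thm64iiDeg R₁ R₂ Ψrlf picMap deg) (ΨBase : FinSubextCat F₁ K₁ ⥤ FinSubextCat F₂ K₂)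
    (π : ∀ X : FinSubextCat F₁ K₁, FinitePlace X.L ≃ FinitePlace (ΨBase.obj X).L)
    (gen : ∀ X : FinSubextCat F₁ K₁, ∃ (A : Rlf₁) (hA : R₁.ops.IsFrobeniusTrivial A)
      (hA' : R₂.ops.IsFrobeniusTrivial (Ψrlf.functor.obj A)), ∀ w : FinitePlace X.L, ∃ g : R₁.Pic A,
        R₁.δ A hA g = logNorm w ∧ R₂.δ _ hA' (picMap A g) = logNorm (π X w)) :
    deg = 1 ∧ ∀ X : FinSubextCat F₁ K₁, IsGalois ℚ X.L → Nonempty (X.L ≃+* (ΨBase.obj X).L) := by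
  have hrel := fun X => logNorm_transport_of_thm64iiDeg R₁ R₂ Ψrlf picMap deg hdeg X (π X) (gen X)
  refine ⟨(Thm64iv_at_of_logNorm_transport ΨBase ⟨⊥⟩ (π ⟨⊥⟩) deg hdeg.1 (hrel ⟨⊥⟩)).1, fun X hX => ?_⟩
  exact (Thm64iv_at_of_logNorm_transport ΨBase X (π X) deg hdeg.1 (hrel X)).2 hX

end Literature.AlgebraicGeometry.Frobenioids

end
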